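import Summits.Ventures.PercRepro.ProfilePointedCircuitClassesStarSharpX

/-! # The six-point lemma, I: the three local facts as rank statements modulo `B` (p5 g53, §80 ADD 7(f))

Setting of §80 ADD 7(f): a rank-3 matroid `M″` on five points `E₅ = {f, u, v, w, w′}` plus a point `b`, realised
inside `N` as `rk_{M″}(S) = rk N (S ∪ B) − r`, `r = rk N B`.  A pair `π = {u, v}` is «in `BI`» when it is independent
and its complement in `E₅` is a basis; it is «ON» when `b ∈ cl(π)`.

* `sixpoint_F0`: an independent pair `{u, v}` avoiding `f`, with `{f, w, w′}` a basis and `f` not a coloop of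
  `M″ ∖ b` (`{u, v, w, w′}` of rank 3), has an endpoint `u` with `{f, u} ∈ BI` — i.e. `{f, u}` independent and
  `{v, w, w′}` a basis (or the same with `u ↔ v`).
All statements are pure rank inequalities, with the membership hypotheses needed for `ρ(X + x) ≤ ρ(X) + 1`. -/

open scoped Matroid

namespace PercRepro.Cogirth

open Finset ThmH Skew Shadow Profile

variable {α : Type} [DecidableEq α] {N : Matroid α} [N.Finite]

section StarSharpY

/-- A point adds at most one to the rank of a set: `ρ({x} ∪ S) ≤ ρ(S) + 1` in union form. -/
theorem rk_singleton_union_le_add_one {x : α} {S : Finset α} (hx : x ∈ gr N) (hS : S ⊆ gr N) :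
    rk N ({x} ∪ S) ≤ rk N S + 1 := by
  rw [singleton_union]
  exact rk_insert_le_add_one hx hS

/-- `ρ(X ∪ Y ∪ B) + ρ(B) ≤ ρ(X ∪ B) + ρ(Y ∪ B)`: submodularity modulo `B`. -/
theorem rk_union_union_add_le {X Y B : Finset α} :
    rk N (X ∪ Y ∪ B) + rk N B ≤ rk N (X ∪ B) + rk N (Y ∪ B) := by
  have h := rk_union_add_rk_le_of_subset_inter (N := N) (S := X ∪ B) (T := Y ∪ B) (I := B)
    (by intro y hy; simp only [mem_inter, mem_union]; tauto)
  have e : X ∪ B ∪ (Y ∪ B) = X ∪ Y ∪ B := by ext y; simp only [mem_union]; tauto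
  rw [e] at h
  exact h

/-- A non-loop modulo `B`: if some set containing `x` has rank `≥ r + 1` more than `B` gives alone … precisely, if
`ρ({x, y} ∪ B) ≥ r + 2` then `ρ({x} ∪ B) ≥ r + 1`. -/
theorem rk_singleton_union_ge_of_pair {x y : α} {B : Finset α} (hy : y ∈ gr N) (hx : x ∈ gr N) (hB : B ⊆ gr N)
    (hxy : rk N B + 2 ≤ rk N ({x, y} ∪ B)) : rk N B + 1 ≤ rk N ({x} ∪ B) := by
  have h1 : rk N ({x, y} ∪ B) ≤ rk N ({x} ∪ B) + 1 := by
    have e : ({x, y} : Finset α) ∪ B = {y} ∪ ({x} ∪ B) := by ext z; simp only [mem_union, mem_insert, mem_singleton]; tauto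
    rw [e]
    exact rk_singleton_union_le_add_one hy (union_subset (singleton_subset_iff.2 hx) hB)
  omega

/-- **(F0) of §80 ADD 7(f)**: for an independent pair `{u, v}` (modulo `B`) with `{f, w, w′}` a basis and
`{u, v, w, w′}` of full rank `r + 3`, either `{f, u}` is independent and `{v, w, w′}` is a basis, or `{f, v}` is
independent and `{u, w, w′}` is a basis — i.e. one of `{f, u}`, `{f, v}` lies in `BI`. -/
theorem sixpoint_F0 {B : Finset α} {f u v w w' : α} (hB : B ⊆ gr N) (hf : f ∈ gr N) (hu : u ∈ gr N) (hv : v ∈ gr N)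
    (hw : w ∈ gr N) (hw' : w' ∈ gr N)
    (huv : rk N B + 2 ≤ rk N ({u, v} ∪ B)) (hfww : rk N B + 3 ≤ rk N ({f, w, w'} ∪ B))
    (hQ : rk N B + 3 ≤ rk N ({u, v, w, w'} ∪ B)) :
    (rk N B + 2 ≤ rk N ({f, u} ∪ B) ∧ rk N B + 3 ≤ rk N ({v, w, w'} ∪ B)) ∨
      (rk N B + 2 ≤ rk N ({f, v} ∪ B) ∧ rk N B + 3 ≤ rk N ({u, w, w'} ∪ B)) := by
  have hww : rk N B + 2 ≤ rk N ({w, w'} ∪ B) := by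
    have h1 : rk N ({f, w, w'} ∪ B) ≤ rk N ({w, w'} ∪ B) + 1 := by
      have e : ({f, w, w'} : Finset α) ∪ B = {f} ∪ ({w, w'} ∪ B) := by
        ext z; simp only [mem_union, mem_insert, mem_singleton]; tauto
      rw [e]
      exact rk_singleton_union_le_add_one hf (union_subset (insert_subset hw (singleton_subset_iff.2 hw')) hB)
    omega
  have hfB : rk N B + 1 ≤ rk N ({f} ∪ B) := by
    -- f is not a loop modulo B: else {f, w, w'} ∪ B would have the rank of {w, w'} ∪ B
    have h := rk_union_union_add_le (N := N) (X := {f}) (Y := {w, w'}) (B := B)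
    have e : ({f} : Finset α) ∪ {w, w'} ∪ B = {f, w, w'} ∪ B := by
      ext z; simp only [mem_union, mem_insert, mem_singleton]
    rw [e] at h
    have h2 : rk N ({w, w'} ∪ B) ≤ rk N B + 2 := by
      have h3 : rk N ({w, w'} ∪ B) ≤ rk N ({w'} ∪ B) + 1 := by
        have e2 : ({w, w'} : Finset α) ∪ B = {w} ∪ ({w'} ∪ B) := by
          ext z; simp only [mem_union, mem_insert, mem_singleton]; tauto
        rw [e2]
        exact rk_singleton_union_le_add_one hw (union_subset (singleton_subset_iff.2 hw') hB)
      have h4 : rk N ({w'} ∪ B) ≤ rk N B + 1 := rk_singleton_union_le_add_one hw' hB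
      omega
    omega
  have huB : rk N B + 1 ≤ rk N ({u} ∪ B) := rk_singleton_union_ge_of_pair hv hu hB huv
  have hvB : rk N B + 1 ≤ rk N ({v} ∪ B) := by
    have e : ({v, u} : Finset α) ∪ B = {u, v} ∪ B := by ext z; simp only [mem_union, mem_insert, mem_singleton]; tauto
    exact rk_singleton_union_ge_of_pair hu hv hB (by rw [e]; exact huv)
  -- key: if x is parallel to f modulo B (ρ({f, x} ∪ B) ≤ r + 1) then x adds what f adds
  have key : ∀ x : α, rk N B + 1 ≤ rk N ({x} ∪ B) → rk N ({f, x} ∪ B) ≤ rk N B + 1 →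
      ∀ Y : Finset α, rk N B + 3 ≤ rk N ({f} ∪ Y ∪ B) → rk N B + 3 ≤ rk N ({x} ∪ Y ∪ B) := by
    intro x hxB hfx Y hY
    have h := rk_union_add_rk_le_of_subset_inter (N := N) (S := {x} ∪ Y ∪ B) (T := {f, x} ∪ B) (I := {x} ∪ B)
      (by intro z hz; simp only [mem_union, mem_inter, mem_insert, mem_singleton] at hz ⊢; tauto)
    have hm : rk N ({f} ∪ Y ∪ B) ≤ rk N ({x} ∪ Y ∪ B ∪ ({f, x} ∪ B)) :=
      rk_mono' (M := N) (by intro z hz; simp only [mem_union, mem_insert, mem_singleton] at hz ⊢; tauto)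
    omega
  -- and then {f, y} is independent whenever {x, y} is
  have key2 : ∀ x y : α, rk N ({f, x} ∪ B) ≤ rk N B + 1 → rk N B + 2 ≤ rk N ({x, y} ∪ B) →
      rk N B + 2 ≤ rk N ({f, y} ∪ B) := by
    intro x y hfx hxy
    have h := rk_union_add_rk_le_of_subset_inter (N := N) (S := {f, y} ∪ B) (T := {f, x} ∪ B) (I := {f} ∪ B)
      (by intro z hz; simp only [mem_union, mem_inter, mem_insert, mem_singleton] at hz ⊢; tauto)
    have hm : rk N ({x, y} ∪ B) ≤ rk N ({f, y} ∪ B ∪ ({f, x} ∪ B)) :=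
      rk_mono' (M := N) (by intro z hz; simp only [mem_union, mem_insert, mem_singleton] at hz ⊢; tauto)
    omega
  by_cases hu3 : rk N B + 3 ≤ rk N ({u, w, w'} ∪ B)
  · by_cases hfv : rk N B + 2 ≤ rk N ({f, v} ∪ B)
    · exact Or.inr ⟨hfv, hu3⟩
    · rw [not_le] at hfv
      left
      refine ⟨key2 v u (by omega) (by
        have e : ({v, u} : Finset α) ∪ B = {u, v} ∪ B := by ext z; simp only [mem_union, mem_insert, mem_singleton]; tauto
        rw [e]; exact huv), ?_⟩
      have h := key v hvB (by omega) {w, w'} (by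
        have e : ({f} : Finset α) ∪ {w, w'} ∪ B = {f, w, w'} ∪ B := by
          ext z; simp only [mem_union, mem_insert, mem_singleton]
        rw [e]; exact hfww)
      have e : ({v} : Finset α) ∪ {w, w'} ∪ B = {v, w, w'} ∪ B := by
        ext z; simp only [mem_union, mem_insert, mem_singleton]
      rw [e] at h
      exact h
  · rw [not_le] at hu3
    -- u lies on the line ww′; then v does not (else {u, v, w, w'} would have rank ≤ r + 2)
    have hv3 : rk N B + 3 ≤ rk N ({v, w, w'} ∪ B) := by
      by_contra hcon
      rw [not_le] at hcon
      have := rk_quad_le_of_on_line (N := N) (B := B) (u := u) (v := v) (w := w) (w' := w') (by omega) (by omega) hww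
      omega
    left
    refine ⟨?_, hv3⟩
    by_contra hfu
    rw [not_le] at hfu
    -- f parallel to u and u on the line ww′ puts f on that line: contradiction with {f, w, w'} a basis
    have h := key u huB (by omega) {w, w'} (by
      have e : ({f} : Finset α) ∪ {w, w'} ∪ B = {f, w, w'} ∪ B := by
        ext z; simp only [mem_union, mem_insert, mem_singleton]
      rw [e]; exact hfww)
    have e : ({u} : Finset α) ∪ {w, w'} ∪ B = {u, w, w'} ∪ B := by
      ext z; simp only [mem_union, mem_insert, mem_singleton]
    rw [e] at h
    omega

/-- Set rewriting helper: `{a, c} ∪ B ⊆ gr N` from memberships. -/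
theorem pair_union_subset_gr {a c : α} {B : Finset α} (ha : a ∈ gr N) (hc : c ∈ gr N) (hB : B ⊆ gr N) :
    ({a, c} : Finset α) ∪ B ⊆ gr N :=
  union_subset (insert_subset ha (singleton_subset_iff.2 hc)) hB

/-- `ρ({x, y, z} ∪ B) ≤ ρ({y, z} ∪ B) + 1`. -/
theorem rk_triple_union_le_pair_add_one {x y z : α} {B : Finset α} (hx : x ∈ gr N) (hy : y ∈ gr N) (hz : z ∈ gr N)
    (hB : B ⊆ gr N) : rk N ({x, y, z} ∪ B) ≤ rk N ({y, z} ∪ B) + 1 := by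
  have e : ({x, y, z} : Finset α) ∪ B = {x} ∪ ({y, z} ∪ B) := by
    ext t; simp only [mem_union, mem_insert, mem_singleton]; tauto
  rw [e]
  exact rk_singleton_union_le_add_one hx (pair_union_subset_gr hy hz hB)

/-- **(P-OFF, a)**: if `b ∉ cl{f, u}` (`ρ({f, u, b} ∪ B) ≥ r + 3`) and `{v₁, v₂, v₃}` is a basis modulo `B`, then `b`
cannot lie on all three lines `uv₁`, `uv₂`, `uv₃` — the line `ub` would hold the whole basis. -/
theorem sixpoint_POFF_not_three {B : Finset α} {f u b v₁ v₂ v₃ : α} (hB : B ⊆ gr N) (hf : f ∈ gr N) (hu : u ∈ gr N)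
    (hb : b ∈ gr N) (hoff : rk N B + 3 ≤ rk N ({f, u, b} ∪ B)) (hQu : rk N B + 3 ≤ rk N ({v₁, v₂, v₃} ∪ B))
    (h1 : rk N ({u, b, v₁} ∪ B) ≤ rk N B + 2) (h2 : rk N ({u, b, v₂} ∪ B) ≤ rk N B + 2)
    (h3 : rk N ({u, b, v₃} ∪ B) ≤ rk N B + 2) : False := by
  have hub : rk N B + 2 ≤ rk N ({u, b} ∪ B) := by
    have := rk_triple_union_le_pair_add_one (N := N) (x := f) (y := u) (z := b) (B := B) hf hu hb hB
    omega
  have := rk_triple_le_of_on_line (N := N) (B := B) (u := u) (b := b) hub h1 h2 h3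
  omega

/-- **(P-OFF, b)**: with `b ∉ cl{f, u}` and `{v₁, v₂, v₃}` a basis modulo `B`, if the two independent pairs `{u, v₁}`,
`{u, v₂}` both contain `b` in their closure, then `{f, v₁}` is independent and `{u, v₂, v₃}` is a basis — i.e.
`{f, v₁} ∈ BI`. -/
theorem sixpoint_POFF_fvBI {B : Finset α} {f u b v₁ v₂ v₃ : α} (hB : B ⊆ gr N) (hf : f ∈ gr N) (hu : u ∈ gr N)
    (hb : b ∈ gr N) (hv₁ : v₁ ∈ gr N) (hoff : rk N B + 3 ≤ rk N ({f, u, b} ∪ B))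
    (hQu : rk N B + 3 ≤ rk N ({v₁, v₂, v₃} ∪ B))
    (huv₁ : rk N B + 2 ≤ rk N ({u, v₁} ∪ B)) (huv₂ : rk N B + 2 ≤ rk N ({u, v₂} ∪ B))
    (h1 : rk N ({u, b, v₁} ∪ B) ≤ rk N B + 2) (h2 : rk N ({u, b, v₂} ∪ B) ≤ rk N B + 2) :
    rk N B + 2 ≤ rk N ({f, v₁} ∪ B) ∧ rk N B + 3 ≤ rk N ({u, v₂, v₃} ∪ B) := by
  have hub : rk N B + 2 ≤ rk N ({u, b} ∪ B) := by
    have := rk_triple_union_le_pair_add_one (N := N) (x := f) (y := u) (z := b) (B := B) hf hu hb hB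
    omega
  -- the line ub contains u, b, v₁, v₂
  have hline : rk N ({u, v₁, v₂, b} ∪ B) ≤ rk N B + 2 := by
    have h := rk_union_add_rk_le_of_subset_inter (N := N) (S := {u, b, v₁} ∪ B) (T := {u, b, v₂} ∪ B)
      (I := {u, b} ∪ B) (by intro z hz; simp only [mem_union, mem_inter, mem_insert, mem_singleton] at hz ⊢; tauto)
    have hm : rk N ({u, v₁, v₂, b} ∪ B) ≤ rk N ({u, b, v₁} ∪ B ∪ ({u, b, v₂} ∪ B)) :=
      rk_mono' (M := N) (by intro z hz; simp only [mem_union, mem_insert, mem_singleton] at hz ⊢; tauto)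
    omega
  constructor
  · -- f is not parallel to v₁: otherwise f would lie on the line ub, i.e. b ∈ cl{f, u}
    by_contra hfv
    rw [not_le] at hfv
    have hv₁B : rk N B + 1 ≤ rk N ({v₁} ∪ B) := by
      have e : ({v₁, u} : Finset α) ∪ B = {u, v₁} ∪ B := by
        ext z; simp only [mem_union, mem_insert, mem_singleton]; tauto
      exact rk_singleton_union_ge_of_pair hu hv₁ hB (by rw [e]; exact huv₁)
    have h := rk_union_add_rk_le_of_subset_inter (N := N) (S := {u, b, v₁} ∪ B) (T := {f, v₁} ∪ B)
      (I := {v₁} ∪ B) (by intro z hz; simp only [mem_union, mem_inter, mem_insert, mem_singleton] at hz ⊢; tauto)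
    have hm : rk N ({f, u, b} ∪ B) ≤ rk N ({u, b, v₁} ∪ B ∪ ({f, v₁} ∪ B)) :=
      rk_mono' (M := N) (by intro z hz; simp only [mem_union, mem_insert, mem_singleton] at hz ⊢; tauto)
    omega
  · exact rk_triple_ge_of_off_line (N := N) (B := B) (u := u) (v := v₁) (v' := v₂) (s := v₃) (b := b) hline hQu huv₂

/-- Reordering a pair under a union. -/
theorem pair_union_swap (a c : α) (B : Finset α) : ({a, c} : Finset α) ∪ B = {c, a} ∪ B := by
  ext z; simp only [mem_union, mem_insert, mem_singleton]; tauto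

/-- Reordering a triple under a union: swap the first two. -/
theorem triple_union_swap12 (a c d : α) (B : Finset α) : ({a, c, d} : Finset α) ∪ B = {c, a, d} ∪ B := by
  ext z; simp only [mem_union, mem_insert, mem_singleton]; tauto

/-- Reordering a triple under a union: swap the last two. -/
theorem triple_union_swap23 (a c d : α) (B : Finset α) : ({a, c, d} : Finset α) ∪ B = {a, d, c} ∪ B := by
  ext z; simp only [mem_union, mem_insert, mem_singleton]; tauto

/-- Reordering a triple under a union: rotate. -/
theorem triple_union_rot (a c d : α) (B : Finset α) : ({a, c, d} : Finset α) ∪ B = {c, d, a} ∪ B := by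
  ext z; simp only [mem_union, mem_insert, mem_singleton]; tauto

/-- Reordering a triple under a union: reverse. -/
theorem triple_union_rev (a c d : α) (B : Finset α) : ({a, c, d} : Finset α) ∪ B = {d, c, a} ∪ B := by
  ext z; simp only [mem_union, mem_insert, mem_singleton]; tauto

/-- **A point on two sides of a triangle is parallel to their common vertex** (modulo `B`): `{p, q, s}` a basis,
`u` on the sides `qs` and `ps` ⇒ `{u, s}` dependent. -/
theorem rk_pair_le_of_on_two_sides' {B : Finset α} {u p q s : α} (hQ : rk N B + 3 ≤ rk N ({p, q, s} ∪ B))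
    (h1 : rk N ({u, q, s} ∪ B) ≤ rk N B + 2) (h2 : rk N ({u, p, s} ∪ B) ≤ rk N B + 2) :
    rk N ({u, s} ∪ B) ≤ rk N B + 1 := by
  rw [triple_union_rev] at h1 h2 hQ
  rw [pair_union_swap]
  exact rk_pair_le_of_on_two_sides (N := N) (B := B) (b := u) (v₁ := s) (v₂ := q) (v₃ := p) h1 h2 hQ

/-- **(P-ON)** — in fact independent of `b`: if `{f, u} ∈ BI` (`{v₁, v₂, v₃}` a basis modulo `B`) and all three pairs
`{u, vᵢ}` are independent with `{f, v₂, v₃}` and `{f, v₁, v₃}` bases (two of the three complements suffice), then at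
least two of the pairs `{f, vᵢ}` are in `BI`: `u` lies on at most one side of the triangle `v₁v₂v₃`. -/
theorem sixpoint_PON {B : Finset α} {f u v₁ v₂ v₃ : α} (hB : B ⊆ gr N) (hf : f ∈ gr N) (hv₁ : v₁ ∈ gr N)
    (hv₂ : v₂ ∈ gr N) (hv₃ : v₃ ∈ gr N) (hQu : rk N B + 3 ≤ rk N ({v₁, v₂, v₃} ∪ B))
    (huv₁ : rk N B + 2 ≤ rk N ({u, v₁} ∪ B)) (huv₂ : rk N B + 2 ≤ rk N ({u, v₂} ∪ B))
    (huv₃ : rk N B + 2 ≤ rk N ({u, v₃} ∪ B))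
    (hc₁ : rk N B + 3 ≤ rk N ({f, v₂, v₃} ∪ B)) (hc₂ : rk N B + 3 ≤ rk N ({f, v₁, v₃} ∪ B)) :
    ((rk N B + 2 ≤ rk N ({f, v₁} ∪ B) ∧ rk N B + 3 ≤ rk N ({u, v₂, v₃} ∪ B)) ∧
      (rk N B + 2 ≤ rk N ({f, v₂} ∪ B) ∧ rk N B + 3 ≤ rk N ({u, v₁, v₃} ∪ B))) ∨
    ((rk N B + 2 ≤ rk N ({f, v₁} ∪ B) ∧ rk N B + 3 ≤ rk N ({u, v₂, v₃} ∪ B)) ∧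
      (rk N B + 2 ≤ rk N ({f, v₃} ∪ B) ∧ rk N B + 3 ≤ rk N ({u, v₁, v₂} ∪ B))) ∨
    ((rk N B + 2 ≤ rk N ({f, v₂} ∪ B) ∧ rk N B + 3 ≤ rk N ({u, v₁, v₃} ∪ B)) ∧
      (rk N B + 2 ≤ rk N ({f, v₃} ∪ B) ∧ rk N B + 3 ≤ rk N ({u, v₁, v₂} ∪ B))) := by
  have hfv₁ : rk N B + 2 ≤ rk N ({f, v₁} ∪ B) := by
    have := rk_triple_union_le_pair_add_one (N := N) (x := v₃) (y := f) (z := v₁) (B := B) hv₃ hf hv₁ hB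
    rw [triple_union_rot] at this
    omega
  have hfv₂ : rk N B + 2 ≤ rk N ({f, v₂} ∪ B) := by
    have := rk_triple_union_le_pair_add_one (N := N) (x := v₃) (y := f) (z := v₂) (B := B) hv₃ hf hv₂ hB
    rw [triple_union_rot] at this
    omega
  have hfv₃ : rk N B + 2 ≤ rk N ({f, v₃} ∪ B) := by
    have := rk_triple_union_le_pair_add_one (N := N) (x := v₂) (y := f) (z := v₃) (B := B) hv₂ hf hv₃ hB
    rw [triple_union_rot, triple_union_swap23] at this
    omega
  have side12 : ¬ (rk N ({u, v₂, v₃} ∪ B) ≤ rk N B + 2 ∧ rk N ({u, v₁, v₃} ∪ B) ≤ rk N B + 2) := by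
    rintro ⟨h1, h2⟩
    have := rk_pair_le_of_on_two_sides' (N := N) (B := B) (u := u) (p := v₁) (q := v₂) (s := v₃) hQu h1 h2
    omega
  have side13 : ¬ (rk N ({u, v₂, v₃} ∪ B) ≤ rk N B + 2 ∧ rk N ({u, v₁, v₂} ∪ B) ≤ rk N B + 2) := by
    rintro ⟨h1, h2⟩
    rw [triple_union_swap23] at h1
    have hQ' := hQu
    rw [triple_union_swap23] at hQ'
    have := rk_pair_le_of_on_two_sides' (N := N) (B := B) (u := u) (p := v₁) (q := v₃) (s := v₂) hQ' h1 h2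
    omega
  have side23 : ¬ (rk N ({u, v₁, v₃} ∪ B) ≤ rk N B + 2 ∧ rk N ({u, v₁, v₂} ∪ B) ≤ rk N B + 2) := by
    rintro ⟨h1, h2⟩
    rw [triple_union_swap23] at h1 h2
    have hQ' := hQu
    rw [triple_union_rot] at hQ'
    have := rk_pair_le_of_on_two_sides' (N := N) (B := B) (u := u) (p := v₂) (q := v₃) (s := v₁) hQ' h1 h2
    omega
  by_cases hA : rk N B + 3 ≤ rk N ({u, v₂, v₃} ∪ B)
  · by_cases hB2 : rk N B + 3 ≤ rk N ({u, v₁, v₃} ∪ B)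
    · exact Or.inl ⟨⟨hfv₁, hA⟩, ⟨hfv₂, hB2⟩⟩
    · rw [not_le] at hB2
      have hC : rk N B + 3 ≤ rk N ({u, v₁, v₂} ∪ B) := by
        by_contra hC
        rw [not_le] at hC
        exact side23 ⟨by omega, by omega⟩
      exact Or.inr (Or.inl ⟨⟨hfv₁, hA⟩, ⟨hfv₃, hC⟩⟩)
  · rw [not_le] at hA
    have hB2 : rk N B + 3 ≤ rk N ({u, v₁, v₃} ∪ B) := by
      by_contra hB2
      rw [not_le] at hB2
      exact side12 ⟨by omega, by omega⟩
    have hC : rk N B + 3 ≤ rk N ({u, v₁, v₂} ∪ B) := by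
      by_contra hC
      rw [not_le] at hC
      exact side13 ⟨by omega, by omega⟩
    exact Or.inr (Or.inr ⟨⟨hfv₂, hB2⟩, ⟨hfv₃, hC⟩⟩)

end StarSharpY

end PercRepro.Cogirth
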